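import Literature.Analysis.Distribution.BracketGeneratingGerms
import HarnessLib

/-!
# Hörmander's bracket condition is invariant under rescaling the fields of the family

Topic `Literature/Analysis/Distribution`. A small supplement to `BracketGeneratingGerms.lean`:
if two smooth families of vector fields agree up to NON-ZERO CONSTANT factors, `X' i = c_i X_i`,
then their iterated brackets agree up to non-zero constants, so the spans of the values of the
iterated brackets coincide at every point and the two families satisfy Hörmander's bracket
condition on the same sets (`isBracketGenerating_iff_of_eq_smul`). Typical use: the bracket
condition for the generator `L = ∑ X_j² + X₀` of a diffusion and for its formal adjoint
`L* = ∑ X_j² - X₀ + (lower order)`, whose families differ by the sign of the drift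
(Rey-Bellet–Thomas 2002, §4; Cuneo–Eckmann–Hairer–Rey-Bellet 2018, §3.1).

## References

* L. Hörmander, *Hypoelliptic second order differential equations*, Acta Math. **119** (1967)
  147–171, Thm 1.1.
-/

noncomputable section

open Set VectorField
open scoped ContDiff

namespace Literature.Analysis.Distribution

variable {E : Type*} [NormedAddCommGroup E] [NormedSpace ℝ E] {κ : Type*} {X X' : κ → E → E}
  {c : κ → ℝ}

/-- Iterated brackets of the rescaled family `X' i = c_i • X_i` are constant multiples of
iterated brackets of `X`. [folklore] -/
theorem IsIteratedLieBracket.exists_eq_smul_of_eq_smul (hX : ∀ i, ContDiff ℝ ∞ (X i))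
    (hX' : ∀ i, X' i = c i • X i) {V' : E → E} (hV' : IsIteratedLieBracket X' V') :
    ∃ a : ℝ, ∃ V : E → E, IsIteratedLieBracket X V ∧ V' = a • V := by
  induction hV' with
  | of i => exact ⟨c i, X i, IsIteratedLieBracket.of i, hX' i⟩
  | lieBracket i _ ih =>
    obtain ⟨a, V, hV, rfl⟩ := ih
    refine ⟨c i * a, VectorField.lieBracket ℝ (X i) V, IsIteratedLieBracket.lieBracket i hV, ?_⟩
    have hXd := (hX i).differentiable (by simp)
    have hVd := (hV.contDiff hX).differentiable (by simp)
    funext y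
    rw [hX' i, Pi.smul_apply, lieBracket_const_smul_left (hXd y),
      lieBracket_const_smul_right (hVd y), smul_smul]

/-- The span of the bracket values of the rescaled family is contained in that of the original
family. [folklore] -/
theorem bracketSpanAt_le_of_eq_smul (hX : ∀ i, ContDiff ℝ ∞ (X i)) (hX' : ∀ i, X' i = c i • X i)
    (x : E) : bracketSpanAt X' x ≤ bracketSpanAt X x := by
  refine Submodule.span_le.2 ?_
  rintro v ⟨V', hV', rfl⟩
  obtain ⟨a, V, hV, rfl⟩ := hV'.exists_eq_smul_of_eq_smul hX hX'
  rw [Pi.smul_apply]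
  exact Submodule.smul_mem _ a (Submodule.subset_span ⟨V, hV, rfl⟩)

/-- **Rescaling by non-zero constants does not change the span of the bracket values.**
[folklore] -/
theorem bracketSpanAt_eq_of_eq_smul (hX : ∀ i, ContDiff ℝ ∞ (X i)) (hX' : ∀ i, X' i = c i • X i)
    (hc : ∀ i, c i ≠ 0) (x : E) : bracketSpanAt X' x = bracketSpanAt X x := by
  refine le_antisymm (bracketSpanAt_le_of_eq_smul hX hX' x) ?_
  have hX'' : ∀ i, ContDiff ℝ ∞ (X' i) := fun i => by rw [hX' i]; exact (hX i).const_smul (c i)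
  refine bracketSpanAt_le_of_eq_smul (c := fun i => (c i)⁻¹) hX'' (fun i => ?_) x
  rw [hX' i, smul_smul, inv_mul_cancel₀ (hc i), one_smul]

/-- **Hörmander's bracket condition is invariant under rescaling the fields by non-zero
constants** (e.g. `X₀ ↦ -X₀`, passing between `L = ∑ X_j² + X₀` and its formal adjoint).
[folklore] -/
theorem isBracketGenerating_iff_of_eq_smul (hX : ∀ i, ContDiff ℝ ∞ (X i))
    (hX' : ∀ i, X' i = c i • X i) (hc : ∀ i, c i ≠ 0) (s : Set E) :
    IsBracketGenerating X' s ↔ IsBracketGenerating X s := by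
  simp only [isBracketGenerating_iff, bracketSpanAt_eq_of_eq_smul hX hX' hc]

end Literature.Analysis.Distribution
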